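import Literature.Analysis.FluidPDE.TorusVelocityMomentPower
import Literature.Analysis.FluidPDE.TorusNSPressureGradientBudget
import Literature.Analysis.FluidPDE.TorusNSSerrinCriterion
import Literature.Analysis.FluidPDE.TorusStrainVorticityIsometry
import HarnessLib

/-!
# Tran–Yu's `L⁶/L⁴`-ratio criterion on `T³`: `∫₀ᵀ ‖u‖⁶_{L⁶}/‖u‖⁴_{L⁴} dt < ∞` prevents blow-up,
# and its enstrophy form `∫₀ᵀ ‖ω‖⁶_{L²}/‖u‖⁴_{L⁴} dt < ∞`

Analysis/FluidPDE proof file (theorems only; no definitions, no named facts).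

search for candidate a priori estimates; no regularity claim (cell `pub-nsfunc`, literature seat:
this file types a PUBLISHED conditional regularity criterion in RATIO form — the `q = 4` member of
Tran–Yu's pressure-moderation family, obtained from the pressure-GRADIENT Calderón–Zygmund bound;
nothing new).

Source: C. V. Tran, X. Yu, *Depletion of nonlinearity in the pressure force driving Navier–Stokes
flows*, Nonlinearity 28 (2015) 1295–1306, §2.2, Theorem 2 and Corollary 3 with their proof
(eqs. (17)–(22); held text `paper:doi-10-1088-0951-7715-28-5-1295`, p. 5). Printed (ℝ³, `ν = 1`):

"A criterion slightly different from (13) can be derived by considering the evolution equation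
for `‖u‖_{L⁴}`. By substituting `q = 4` into (9), we obtain
`‖u‖³_{L⁴} d/dt ‖u‖_{L⁴} = −∫|u|²u·∇p dx + ∫|u|²(Δ|u|²/2 − |∇u|²) dx`
`≤ ∫|u|³|∇p| dx − 2∫|u|²|∇|u||² dx − ∫|u|²|∇u|² dx`
`≤ ‖u‖³_{L⁶}‖∇p‖_{L²} − 2∫|u|²|∇|u||² dx − ‖|u|∇u‖²_{L²} ≤ c‖u‖⁶_{L⁶} − 2∫|u|²|∇|u||² dx`, (17)
where Hölder's inequality, (5) [`‖∇p‖_{L^q} ≤ c‖|u|∇u‖_{L^q}`] and Young's inequality have been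
used. It follows that `d/dt ‖u‖_{L⁴} ≤ c‖u‖⁶_{L⁶}/‖u‖³_{L⁴}` (18).
**Theorem 2.** Let `u` and `p` solve the Navier–Stokes equations (1). If
`∫₀ᵗ ‖u‖⁶_{L⁶}/‖u‖⁴_{L⁴} dτ < ∞` (19), then `‖u‖_{L⁴} ≤ ‖u₀‖_{L⁴} exp{c∫₀ᵗ ‖u‖⁶_{L⁶}/‖u‖⁴_{L⁴} dτ}`
(20) and regularity follows. By invoking the Sobolev inequality, this result implies a further
corollary. **Corollary 3.** If `∫₀ᵗ ‖ω‖⁶_{L²}/‖u‖⁴_{L⁴} dτ < ∞` (21), then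
`‖u‖_{L⁴} ≤ ‖u₀‖_{L⁴} exp{c∫₀ᵗ ‖ω‖⁶_{L²}/‖u‖⁴_{L⁴} dτ}` (22) and regularity follows."

Here on the unit torus `T^d` in the tree's classical vocabulary, in CONTINUATION FORM at a putative
blow-up time (as the tree renders every criterion of this kind, cf. the companion file
`TorusNSTranYuPressureRatioCriterion` for Theorem 1 / Corollary 1 of the same paper): the
hypothesis (19) becomes a continuous majorant `M(t)` of the RATIO written without quotients,
`∫‖u(t)‖⁶ ≤ M(t) ∫‖u(t)‖⁴`, with `∫₀ᵗ M ≤ I` on `[0, T)`.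

* `TranYu2015.exists_deriv_integral_norm_pow_four_le` — **(17)–(18)** on `T^d` (any finite `d`):
  there is `K ≥ 0` (`K = C₂²`, `C₂` the constant of the tree's periodic pressure-gradient bound
  `‖∇p‖_{L²} ≤ C₂‖(u·∇)u‖_{L²}`, `Torus.exists_gradPressure_Ls_le_convect`, RRS 2016 Lemma 5.1
  (5.8) = Tran–Yu (5) at `q = 2`) such that along every classical solution of the unforced
  equations (`ν > 0`) on `[a, b] × T^d`, every one-sided derivative `R` of `s ↦ ∫‖u(s)‖⁴` at
  `t ∈ [a, b]` satisfies `R ≤ (K/ν) ∫‖u(t)‖⁶` — the printed chain (17): the EXACT `L⁴` balance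
  (tree `Torus.IsClassicalNSSolutionOn.hasDerivWithinAt_integral_normSq_pow`, `m = 2`:
  `R = −4ν∫|u|²|∇u|² − 2ν∫|∇|u|²|² − 4∫|u|²u·∇p`), `|∫|u|²u·∇p| ≤ ‖u‖³_{L⁶}‖∇p‖_{L²}`
  (Cauchy–Schwarz), (5), `|(u·∇)u| ≤ |u||∇u|`, Young against `−4ν‖|u|∇u‖²_{L²}`.
* `Torus.exists_classicalNS_integral_norm_pow_four_le_mul_exp` — **(20)**: with the same `K`,
  `∫‖u(t)‖⁴ ≤ (∫‖u(0)‖⁴) exp((K/ν) ∫₀ᵗ M)` on `[0, T)` (Grönwall, tree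
  `le_mul_exp_integral_of_hasDerivWithinAt_le_mul`).
* `Torus.classicalNS_continuation_of_L6_L4_ratio_integral_le` — **Theorem 2 on `T³`**: the ratio
  majorant with bounded primitive ⇒ continuation past `T` ("regularity follows" = Serrin with
  the constant majorant `sup_t ‖u(t)‖_{L⁴}`, `4 > 3`, tree
  `Torus.classicalNS_continuation_of_Ls_rpow_integral_le`).
* `Torus.classicalNS_continuation_of_enstrophy_L4_ratio_integral_le` — **Corollary 3 on `T³`**:
  `(∫|ω(t)|²)³ ≤ M(t) ∫‖u(t)‖⁴`, `∫₀ᵗ M ≤ I` ⇒ continuation (the tree's periodic Sobolev bound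
  `∫|u|⁶ ≤ C_S (∫|∇u|²)³` for mean-zero fields,
  `Torus.exists_integral_norm_pow_six_le_gradNormSq_cube`, and `∫|∇u|² = ∫|ω|²` for
  divergence-free fields, `integral_torusVorticitySqAt_eq_two_mul_torusEnstrophy`).

Scope (faithfulness): classical solutions of the unforced system on the unit torus (the paper:
ℝ³), mean-zero velocity slices for Theorem 2 / Corollary 3 (Serrin continuation and the Sobolev
inequality on `T³`); (17)–(18) and (20) hold for every classical solution on `T^d`, any finite `d`,
with the constant `K/ν = C₂²/ν` in place of the printed inexplicit `c` (`ν = 1`); (18)/(20) are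
typed for `‖u‖⁴_{L⁴}` (`d/dt‖u‖⁴_{L⁴} ≤ 4c‖u‖⁶_{L⁶}`, the printed form divided by `‖u‖³_{L⁴}` where
it is nonzero). NOT typed: Corollary 2 (`q = 3`, "regularity follows" from `u ∈ L^∞(0,T;L³)` is the
Escauriaza–Seregin–Šverák theorem, not in the tree on `T³`) and Theorem 3 ((23)–(27): its step
(26), the HOMOGENEOUS Sobolev inequality `‖∇|u|^{q/2}‖_{L²} ≥ c‖|u|^{q/2}‖_{L⁶}`, is an `ℝ³`
statement that fails on `T³` — e.g. `u = (sin 2πx₃, cos 2πx₃, 0)` has `|u| ≡ 1`).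
-- TODO(general form): Cor 2 via ESS on `T³`; Thm 3 with the inhomogeneous periodic Sobolev bound.

## Mathlib / tree search

Tree (used): `Torus.IsClassicalNSSolutionOn.hasDerivWithinAt_integral_normSq_pow`
(`TorusVelocityMomentPower`), `integral_deriv_comp_normSq_mul_inner_gradient`
(`TorusVelocityMomentBalance`, the pressure term by parts),
`Torus.exists_gradPressure_Ls_le_convect` (`TorusNSPressureGradientBudget`),
`Torus.exists_integral_norm_pow_six_le_gradNormSq_cube` (`TorusNSChessboardTimeAverages`),
`integral_torusVorticitySqAt_eq_two_mul_torusEnstrophy` (`TorusStrainVorticityIsometry`),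
`le_mul_exp_integral_of_hasDerivWithinAt_le_mul` (`ExtremeGrowthVorticityControl`),
`Torus.classicalNS_continuation_of_Ls_rpow_integral_le` (`TorusNSSerrinCriterion`),
`Torus.fderiv_apply_eq_sum_partialDeriv`; Mathlib `integral_mul_le_Lp_mul_Lq_of_nonneg`,
`Real.sum_mul_le_sqrt_mul_sqrt`, `abs_real_inner_le_norm`.
Searched (`lean search`): `TranYu20|L6_L4|norm_pow_four_le.*six` — the tree has Theorem 1 /
Corollary 1 of the paper (`TorusNSTranYuPressureRatioCriterion`) and the Tran–Yu 2016/2017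
restatements of Seregin–Šverák, not Theorem 2 / Corollary 3 — added here.

## References

* [TranYu2015] C. V. Tran, X. Yu, *Depletion of nonlinearity in the pressure force driving
  Navier–Stokes flows*, Nonlinearity 28 (2015) 1295–1306, doi:10.1088/0951-7715/28/5/1295 —
  Thm 2 (19)–(20), Cor 3 (21)–(22), proof (17)–(18), pressure-gradient bound (5) (held text p. 3,
  p. 5).
* [RobinsonRodrigoSadowskiCUP2016] J. C. Robinson, J. L. Rodrigo, W. Sadowski, *The
  Three-Dimensional Navier–Stokes Equations*, CUP 2016, Lemma 5.1 (5.8), Exercise 11.4 (11.19),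
  Lemma 8.16 / Thm 8.17 (Serrin), via the tree files above.
* [AyalaProtas2017] D. Ayala, B. Protas, J. Fluid Mech. 818 (2017), eq. (2.4)
  (`∫|∇×u|² = ∫|∇u|²`, via the tree).
-/

noncomputable section

open MeasureTheory Finset Set Filter Topology
open scoped InnerProductSpace RealInnerProductSpace ContDiff

namespace Literature.Analysis.FluidPDE

open Literature.Analysis.FunctionSpaces

variable {d : Type*} [Fintype d] [DecidableEq d]

namespace TranYu2015

/-! ### §1 Helpers -/

omit [DecidableEq d] in
/-- Cauchy–Schwarz on `T^d` for continuous non-negative `f, g`: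
`∫ f g ≤ (∫ f²)^{1/2} (∫ g²)^{1/2}`. [folklore] -/
private theorem integral_mul_le_sqrt_mul_sqrt {f g : UnitAddTorus d → ℝ} (hf : Continuous f)
    (hg : Continuous g) (hf0 : ∀ x, 0 ≤ f x) (hg0 : ∀ x, 0 ≤ g x) :
    ∫ x, f x * g x ≤ (∫ x, f x ^ 2) ^ (1 / 2 : ℝ) * (∫ x, g x ^ 2) ^ (1 / 2 : ℝ) := by
  have h := integral_mul_le_Lp_mul_Lq_of_nonneg (μ := volume) Real.HolderConjugate.two_two
    (ae_of_all _ hf0) (ae_of_all _ hg0)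
    (hf.memLp_of_hasCompactSupport (HasCompactSupport.of_compactSpace f))
    (hg.memLp_of_hasCompactSupport (HasCompactSupport.of_compactSpace g))
  simpa only [Real.rpow_two] using h

/-- `‖(v·∇)w (x)‖² ≤ ‖v(x)‖² · ∑ᵢ ‖∂ᵢw(x)‖²` for a `C¹` field `w` on `T^d` (Cauchy–Schwarz in `ℝ^d`
after `(v·∇)w = ∑ᵢ vᵢ ∂ᵢw`; Tran–Yu write `|u|∇u` for the majorant of `(u·∇)u`). [folklore] -/
private theorem norm_convect_sq_le {v w : UnitAddTorus d → EuclideanSpace ℝ d}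
    (hw : Torus.IsContDiff 1 w) (x : UnitAddTorus d) :
    ‖Torus.convect v w x‖ ^ 2 ≤ ‖v x‖ ^ 2 * ∑ i, ‖Torus.partialDeriv i w x‖ ^ 2 := by
  have hconv : Torus.convect v w x = ∑ i, v x i • Torus.partialDeriv i w x :=
    Torus.fderiv_apply_eq_sum_partialDeriv hw x (v x)
  have hS0 : 0 ≤ ∑ i, ‖Torus.partialDeriv i w x‖ ^ 2 := Finset.sum_nonneg fun _ _ => sq_nonneg _
  have h1 : ‖Torus.convect v w x‖ ≤ ‖v x‖ * Real.sqrt (∑ i, ‖Torus.partialDeriv i w x‖ ^ 2) := by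
    rw [hconv, EuclideanSpace.norm_eq (v x)]
    calc ‖∑ i, v x i • Torus.partialDeriv i w x‖
        ≤ ∑ i, ‖v x i‖ * ‖Torus.partialDeriv i w x‖ :=
          (norm_sum_le _ _).trans (le_of_eq (Finset.sum_congr rfl fun i _ => norm_smul _ _))
      _ ≤ Real.sqrt (∑ i, ‖v x i‖ ^ 2) * Real.sqrt (∑ i, ‖Torus.partialDeriv i w x‖ ^ 2) :=
          Real.sum_mul_le_sqrt_mul_sqrt _ _ _
  have h2 := pow_le_pow_left₀ (norm_nonneg _) h1 2
  rw [mul_pow, Real.sq_sqrt hS0] at h2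
  exact h2

/-- `s ↦ ∫‖u(s)‖⁴` is differentiable within `[a, b]` along a classical solution (the exact `L⁴`
balance of the tree, `m = 2`). [folklore] -/
private theorem exists_hasDerivWithinAt_integral_norm_pow_four {a b ν : ℝ}
    {f u : ℝ → UnitAddTorus d → EuclideanSpace ℝ d} {p : ℝ → UnitAddTorus d → ℝ}
    (h : Torus.IsClassicalNSSolutionOn (Icc a b) ν f u p) (hab : a < b) {t : ℝ}
    (ht : t ∈ Icc a b) :
    ∃ R : ℝ, HasDerivWithinAt (fun s => ∫ x, ‖u s x‖ ^ 4) R (Icc a b) t := by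
  classical
  have hD := h.hasDerivWithinAt_integral_normSq_pow hab 2 ht
  have e : (fun s => ∫ x, ‖u s x‖ ^ 4) = fun s => ∫ x, (‖u s x‖ ^ 2) ^ 2 := by
    funext s
    refine integral_congr_ae (ae_of_all _ fun x => ?_)
    show ‖u s x‖ ^ 4 = (‖u s x‖ ^ 2) ^ 2
    ring
  rw [e]
  exact ⟨_, hD⟩

/-! ### §2 The differential inequality (Tran–Yu (17)–(18)) -/

/-- **The `L⁴` energy inequality through the pressure GRADIENT** (Tran–Yu 2015, (17)–(18):
"`‖u‖³_{L⁴} d/dt‖u‖_{L⁴} ≤ ‖u‖³_{L⁶}‖∇p‖_{L²} − 2∫|u|²|∇|u||² − ‖|u|∇u‖²_{L²} ≤ c‖u‖⁶_{L⁶} −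
2∫|u|²|∇|u||²` … It follows that `d/dt‖u‖_{L⁴} ≤ c‖u‖⁶_{L⁶}/‖u‖³_{L⁴}`", using their (5)
`‖∇p‖_{L²} ≤ c‖|u|∇u‖_{L²}`). On `T^d` (any finite `d`): there is `K ≥ 0` — `K = C₂²` with `C₂`
the constant of the tree's periodic bound `‖∇p‖_{L²} ≤ C₂‖(u·∇)u‖_{L²}`
(`Torus.exists_gradPressure_Ls_le_convect` at `r = 2`) — such that along every classical solution
of the unforced Navier–Stokes equations with `ν > 0` on `[a, b] × T^d`, for every `t ∈ [a, b]`
and every one-sided derivative `R` of `s ↦ ∫‖u(s)‖⁴` within `[a, b]` at `t`,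
`R ≤ (K/ν) ∫‖u(t)‖⁶`.
Proof = the printed chain (17): the exact balance
`R = −4ν∫|u|²∑ₖ‖∂ₖu‖² − 2ν∫∑ₖ(∂ₖ|u|²)² + 4∫p (u·∇)|u|²`
(`Torus.IsClassicalNSSolutionOn.hasDerivWithinAt_integral_normSq_pow`, `m = 2`), the pressure
term rewritten as `−4∫|u|²⟪u, ∇p⟫` (`integral_deriv_comp_normSq_mul_inner_gradient`),
Cauchy–Schwarz `≤ 4‖u‖³_{L⁶}‖∇p‖_{L²}`, (5), `‖(u·∇)u‖ ≤ |u|(∑ₖ‖∂ₖu‖²)^{1/2}` and Young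
`4C₂XY ≤ 4νY² + (C₂²/ν)X²`. [cite: TranYu2015, eqs. (17)–(18) (proof of Thm 2)] -/
theorem exists_deriv_integral_norm_pow_four_le [Nonempty d] :
    ∃ K : ℝ, 0 ≤ K ∧ ∀ {a b ν : ℝ}, 0 < ν → a < b →
      ∀ {u : ℝ → UnitAddTorus d → EuclideanSpace ℝ d} {p : ℝ → UnitAddTorus d → ℝ},
        Torus.IsClassicalNSSolutionOn (Icc a b) ν 0 u p → ∀ t ∈ Icc a b, ∀ {R : ℝ},
          HasDerivWithinAt (fun s => ∫ x, ‖u s x‖ ^ 4) R (Icc a b) t →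
            R ≤ K / ν * ∫ x, ‖u t x‖ ^ 6 := by
  classical
  obtain ⟨C, hC0, hC⟩ := Torus.exists_gradPressure_Ls_le_convect (d := d) (r := 2) one_lt_two
  refine ⟨C ^ 2, sq_nonneg _, fun {a b ν} hν hab {u p} h t ht {R} hR => ?_⟩
  have hU : UniqueDiffWithinAt ℝ (Icc a b) t := uniqueDiffOn_Icc hab t ht
  have hut : Torus.IsSmooth (u t) := h.smooth_velocity.isSmooth_slice ht
  have hpt : Torus.IsSmooth (p t) := h.smooth_pressure.isSmooth_slice ht
  have hdivt : Torus.IsDivFree (u t) := h.divFree t ht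
  have hu1 : Torus.IsContDiff 1 (u t) := hut.isContDiff (by simp)
  have hQ : Torus.IsSmooth (fun y => ‖u t y‖ ^ 2) := hut.norm_sq
  have hGp : Torus.IsSmooth (Torus.gradient (p t)) := hpt.gradient
  have hConv : Torus.IsSmooth (Torus.convect (u t) (u t)) := hut.convect hut
  -- notation for the four integrals of the balance
  set Q : UnitAddTorus d → ℝ := fun y => ‖u t y‖ ^ 2 with hQdef
  set X : ℝ := ∫ x, ‖u t x‖ ^ 2 * ∑ k, ‖Torus.partialDeriv k (u t) x‖ ^ 2 with hX
  set Y : ℝ := ∫ x, ∑ k, Torus.partialDeriv k Q x ^ 2 with hY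
  set P : ℝ := ∫ x, p t x * ∑ k, u t x k * Torus.partialDeriv k Q x with hP
  set A : ℝ := ∫ x, ‖u t x‖ ^ 6 with hA
  set G : ℝ := ∫ x, ‖Torus.gradient (p t) x‖ ^ 2 with hG
  have hgrad0 : ∀ x, 0 ≤ ∑ k, ‖Torus.partialDeriv k (u t) x‖ ^ 2 := fun x =>
    Finset.sum_nonneg fun _ _ => sq_nonneg _
  have hX0 : 0 ≤ X := integral_nonneg fun x => mul_nonneg (sq_nonneg _) (hgrad0 x)
  have hY0 : 0 ≤ Y := integral_nonneg fun x => Finset.sum_nonneg fun _ _ => sq_nonneg _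
  have hA0 : 0 ≤ A := integral_nonneg fun x => pow_nonneg (norm_nonneg _) _
  have hG0 : 0 ≤ G := integral_nonneg fun x => sq_nonneg _
  -- Step 1: the exact `L⁴` balance, `R = −ν(4X + 2Y) + 4P`
  have hD := h.hasDerivWithinAt_integral_normSq_pow hab 2 ht
  have e_fun : (fun s => ∫ x, ‖u s x‖ ^ 4) = fun s => ∫ x, (‖u s x‖ ^ 2) ^ 2 := by
    funext s
    refine integral_congr_ae (ae_of_all _ fun x => ?_)
    show ‖u s x‖ ^ 4 = (‖u s x‖ ^ 2) ^ 2
    ring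
  rw [e_fun] at hR
  have hReq := (hR.derivWithin hU).symm.trans (hD.derivWithin hU)
  have hRval : R = -(ν * (4 * X + 2 * Y)) + 4 * P := by
    rw [hReq]
    simp only [Pi.zero_apply, inner_zero_right, mul_zero, integral_zero, add_zero, Nat.cast_ofNat,
      show (2 : ℕ) - 1 = 1 from rfl, show (2 : ℕ) - 2 = 0 from rfl, pow_one, pow_zero, one_mul]
    rw [hX, hY, hP]
    ring
  -- Step 2: the pressure term through the gradient, `P = −∫ |u|² ⟪u, ∇p⟫`
  have hg : ContDiffOn ℝ ∞ (fun s : ℝ => s ^ 2) univ := (contDiff_id.pow 2).contDiffOn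
  have hd1 : ∀ y : ℝ, deriv (fun s : ℝ => s ^ 2) y = 2 * y := fun y => by simp
  have hd2 : ∀ y : ℝ, deriv (deriv (fun s : ℝ => s ^ 2)) y = 2 := fun y => by
    rw [show deriv (fun s : ℝ => s ^ 2) = fun y => 2 * y from funext hd1]
    simp
  have hIBP := integral_deriv_comp_normSq_mul_inner_gradient hut hdivt hpt isOpen_univ hg
    (fun _ => mem_univ _)
  simp only [hd1, hd2] at hIBP
  -- `hIBP : ∫ 2Q ⟪u, ∇p⟫ = −∫ p (2 ∑ₖ uₖ ∂ₖQ)`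
  have hPeq : P = -∫ x, Q x * ⟪u t x, Torus.gradient (p t) x⟫ := by
    have e1 : ∫ x, 2 * ‖u t x‖ ^ 2 * ⟪u t x, Torus.gradient (p t) x⟫ =
        2 * ∫ x, Q x * ⟪u t x, Torus.gradient (p t) x⟫ := by
      rw [← integral_const_mul]
      exact integral_congr_ae (ae_of_all _ fun x => by rw [hQdef]; ring)
    have e2 : ∫ x, p t x * (2 * ∑ k, u t x k * Torus.partialDeriv k (fun y => ‖u t y‖ ^ 2) x) =
        2 * P := by
      rw [hP, ← integral_const_mul]
      exact integral_congr_ae (ae_of_all _ fun x => by rw [hQdef]; ring)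
    rw [e1, e2] at hIBP
    linarith
  -- Step 3: `−∫|u|²⟪u,∇p⟫ ≤ ∫‖u‖³‖∇p‖ ≤ A^{1/2} G^{1/2}` (Cauchy–Schwarz twice)
  have hwc : Continuous fun x => ‖u t x‖ := hut.continuous.norm
  have hgc : Continuous fun x => ‖Torus.gradient (p t) x‖ := hGp.continuous.norm
  have hP_le : P ≤ A ^ (1 / 2 : ℝ) * G ^ (1 / 2 : ℝ) := by
    have h1 : P ≤ ∫ x, ‖u t x‖ ^ 3 * ‖Torus.gradient (p t) x‖ := by
      rw [hPeq, ← integral_neg]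
      refine integral_mono ?_ ((hwc.pow 3).mul hgc).integrable_unitAddTorus fun x => ?_
      · exact (hQ.continuous.mul (hut.continuous.inner hGp.continuous)).neg.integrable_unitAddTorus
      · have hi := abs_real_inner_le_norm (u t x) (Torus.gradient (p t) x)
        have h3 : -⟪u t x, Torus.gradient (p t) x⟫ ≤ ‖u t x‖ * ‖Torus.gradient (p t) x‖ := by
          have := (abs_le.mp hi).1
          linarith
        have hQx : Q x = ‖u t x‖ ^ 2 := rfl
        show -(Q x * ⟪u t x, Torus.gradient (p t) x⟫) ≤ ‖u t x‖ ^ 3 * ‖Torus.gradient (p t) x‖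
        rw [hQx]
        have e : ‖u t x‖ ^ 3 * ‖Torus.gradient (p t) x‖ =
            ‖u t x‖ ^ 2 * (‖u t x‖ * ‖Torus.gradient (p t) x‖) := by ring
        rw [e, ← mul_neg]
        exact mul_le_mul_of_nonneg_left h3 (sq_nonneg _)
    have h2 := integral_mul_le_sqrt_mul_sqrt (f := fun x => ‖u t x‖ ^ 3)
      (g := fun x => ‖Torus.gradient (p t) x‖) (hwc.pow 3) hgc
      (fun x => pow_nonneg (norm_nonneg _) _) (fun x => norm_nonneg _)
    have e3 : ∫ x, (‖u t x‖ ^ 3) ^ 2 = A := by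
      rw [hA]; exact integral_congr_ae (ae_of_all _ fun x => by ring)
    rw [e3] at h2
    exact h1.trans h2
  -- Step 4: the pressure-gradient bound (5): `G^{1/2} ≤ C X^{1/2}`
  have hG_le : G ^ (1 / 2 : ℝ) ≤ C * X ^ (1 / 2 : ℝ) := by
    have h1 := hC hab h t ht
    simp only [Real.rpow_two] at h1
    have h2 : ∫ x, ‖Torus.convect (u t) (u t) x‖ ^ 2 ≤ X := by
      refine integral_mono_of_nonneg (ae_of_all _ fun x => sq_nonneg _) ?_
        (ae_of_all _ fun x => norm_convect_sq_le hu1 x)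
      have hc : Continuous fun x => ‖u t x‖ ^ 2 * ∑ k, ‖Torus.partialDeriv k (u t) x‖ ^ 2 :=
        (hwc.pow 2).mul (continuous_finsetSum _ fun k _ =>
          ((hut.partialDeriv k).continuous.norm).pow 2)
      exact hc.integrable_unitAddTorus
    have h0 : 0 ≤ ∫ x, ‖Torus.convect (u t) (u t) x‖ ^ 2 := integral_nonneg fun x => sq_nonneg _
    have h3 : (∫ x, ‖Torus.convect (u t) (u t) x‖ ^ 2) ^ (1 / 2 : ℝ) ≤ X ^ (1 / 2 : ℝ) :=
      Real.rpow_le_rpow h0 h2 (by norm_num)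
    exact h1.trans (mul_le_mul_of_nonneg_left h3 hC0)
  -- Step 5: Young and assembly
  set α : ℝ := A ^ (1 / 2 : ℝ) with hα
  set ξ : ℝ := X ^ (1 / 2 : ℝ) with hξ
  have hα0 : 0 ≤ α := Real.rpow_nonneg hA0 _
  have hξ0 : 0 ≤ ξ := Real.rpow_nonneg hX0 _
  have hα2 : α ^ 2 = A := by
    rw [hα, ← Real.rpow_natCast, ← Real.rpow_mul hA0]; norm_num
  have hξ2 : ξ ^ 2 = X := by
    rw [hξ, ← Real.rpow_natCast, ← Real.rpow_mul hX0]; norm_num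
  have hP4 : 4 * P ≤ 4 * C * α * ξ := by
    have := hP_le.trans (mul_le_mul_of_nonneg_left hG_le hα0)
    nlinarith [this]
  have hyoung : 4 * C * α * ξ ≤ 4 * ν * ξ ^ 2 + C ^ 2 / ν * α ^ 2 := by
    have key : 4 * C * α * ξ * ν ≤ (4 * ν * ξ ^ 2 + C ^ 2 / ν * α ^ 2) * ν := by
      have e : (4 * ν * ξ ^ 2 + C ^ 2 / ν * α ^ 2) * ν = 4 * ν ^ 2 * ξ ^ 2 + C ^ 2 * α ^ 2 := by
        field_simp
      rw [e]
      nlinarith [sq_nonneg (2 * ν * ξ - C * α)]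
    exact le_of_mul_le_mul_right key hν
  rw [hα2, hξ2] at hyoung
  have hνY : 0 ≤ ν * Y := mul_nonneg hν.le hY0
  calc R = -(ν * (4 * X + 2 * Y)) + 4 * P := hRval
    _ ≤ -(4 * ν * X) + 4 * C * α * ξ := by linarith
    _ ≤ C ^ 2 / ν * A := by linarith

end TranYu2015

/-! ### §3 Theorem 2 and Corollary 3 along classical solutions on `T³` -/

section Criterion

variable {ν T : ℝ} {u : ℝ → UnitAddTorus d → EuclideanSpace ℝ d} {p : ℝ → UnitAddTorus d → ℝ}

/-- **Tran–Yu's bound (20) on `T^d`: `‖u(t)‖⁴_{L⁴} ≤ ‖u₀‖⁴_{L⁴} exp(C∫₀ᵗ ‖u‖⁶_{L⁶}/‖u‖⁴_{L⁴})`.**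
There is `K ≥ 0` (the constant of `TranYu2015.exists_deriv_integral_norm_pow_four_le`) such that
along every classical solution of the unforced Navier–Stokes equations (`ν > 0`) on
`[0, T) × T^d`: if `M` is continuous on `[0, T)` and `∫‖u(t)‖⁶ ≤ M(t) ∫‖u(t)‖⁴` for all
`t ∈ [0, T)` (the ratio `‖u‖⁶_{L⁶}/‖u‖⁴_{L⁴} ≤ M` written without quotients), then
`∫‖u(t)‖⁴ ≤ (∫‖u(0)‖⁴) · exp((K/ν) ∫₀ᵗ M)` for every `t ∈ [0, T)` (printed, `ν = 1`:
"`‖u‖_{L⁴} ≤ ‖u₀‖_{L⁴} exp{c∫₀ᵗ ‖u‖⁶_{L⁶}/‖u‖⁴_{L⁴} dτ}`"; Grönwall on (17)–(18), the tree's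
`le_mul_exp_integral_of_hasDerivWithinAt_le_mul`). [cite: TranYu2015, Thm 2 eq. (20)] -/
theorem Torus.exists_classicalNS_integral_norm_pow_four_le_mul_exp [Nonempty d] :
    ∃ K : ℝ, 0 ≤ K ∧ ∀ {ν T : ℝ} {u : ℝ → UnitAddTorus d → EuclideanSpace ℝ d}
      {p : ℝ → UnitAddTorus d → ℝ}, 0 < ν → Torus.IsClassicalNSSolutionOn (Ico 0 T) ν 0 u p →
        ∀ {M : ℝ → ℝ}, ContinuousOn M (Ico 0 T) →
          (∀ t ∈ Ico 0 T, ∫ x, ‖u t x‖ ^ 6 ≤ M t * ∫ x, ‖u t x‖ ^ 4) →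
            ∀ t ∈ Ico 0 T, ∫ x, ‖u t x‖ ^ 4 ≤
              (∫ x, ‖u 0 x‖ ^ 4) * Real.exp (K / ν * ∫ τ in (0 : ℝ)..t, M τ) := by
  obtain ⟨K, hK0, hK⟩ := TranYu2015.exists_deriv_integral_norm_pow_four_le (d := d)
  refine ⟨K, hK0, fun {ν T u p} hν h {M} hMc hM t ht => ?_⟩
  set X : ℝ → ℝ := fun s => ∫ x, ‖u s x‖ ^ 4 with hX
  have hXnn : ∀ s, 0 ≤ X s := fun s => integral_nonneg fun x => pow_nonneg (norm_nonneg _) _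
  rcases ht.1.eq_or_lt with h0 | h0t
  · rw [← h0]; simp
  have hsub : Icc 0 t ⊆ Ico 0 T := fun s hs => ⟨hs.1, hs.2.trans_lt ht.2⟩
  have h' : Torus.IsClassicalNSSolutionOn (Icc 0 t) ν 0 u p := h.mono hsub (uniqueDiffOn_Icc h0t)
  have hder : ∀ s ∈ Icc 0 t, ∃ R, HasDerivWithinAt X R (Icc 0 t) s := fun s hs =>
    TranYu2015.exists_hasDerivWithinAt_integral_norm_pow_four h' h0t hs
  choose! Xd hXd using hder
  set k : ℝ → ℝ := fun s => K / ν * M s with hk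
  have hkc : ContinuousOn k (Icc 0 t) := continuousOn_const.mul (hMc.mono hsub)
  have hKν : 0 ≤ K / ν := div_nonneg hK0 hν.le
  have hle : ∀ s ∈ Icc 0 t, Xd s ≤ k s * X s := by
    intro s hs
    have h1 := hK hν h0t h' s hs (hXd s hs)
    calc Xd s ≤ K / ν * ∫ x, ‖u s x‖ ^ 6 := h1
      _ ≤ K / ν * (M s * ∫ x, ‖u s x‖ ^ 4) := mul_le_mul_of_nonneg_left (hM s (hsub hs)) hKν
      _ = k s * X s := by rw [hk, hX]; ring
  have hG := le_mul_exp_integral_of_hasDerivWithinAt_le_mul h0t hXd hkc hle ⟨h0t.le, le_rfl⟩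
  have e : ∫ s in (0 : ℝ)..t, k s = K / ν * ∫ τ in (0 : ℝ)..t, M τ := by
    rw [hk]; exact intervalIntegral.integral_const_mul _ _
  rw [e] at hG
  exact hG

/-- **Tran–Yu's Theorem 2 on `T³` (continuation form): `∫₀ᵀ ‖u‖⁶_{L⁶}/‖u‖⁴_{L⁴} < ∞` prevents
blow-up.** Printed (ℝ³, `ν = 1`): "Let `u` and `p` solve the Navier–Stokes equations (1). If
`∫₀ᵗ ‖u‖⁶_{L⁶}/‖u‖⁴_{L⁴} dτ < ∞` (19), then `‖u‖_{L⁴} ≤ ‖u₀‖_{L⁴} exp{c∫₀ᵗ ‖u‖⁶_{L⁶}/‖u‖⁴_{L⁴} dτ}`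
(20) and regularity follows." Here: a classical solution of the unforced Navier–Stokes equations
(`ν > 0`) on `[0, T) × T^d`, `card d = 3`, `T > 0`, with mean-zero velocity slices, a continuous
`M` on `[0, T)` with `∫‖u(t)‖⁶ ≤ M(t) ∫‖u(t)‖⁴` and `∫₀ᵗ M ≤ I` on `[0, T)`: then the solution
continues to a classical solution with mean-zero slices on some `[0, T'] × T^d`, `T' > T`, equal
to `u` on `[0, T)`. Proof: (20) (`Torus.exists_classicalNS_integral_norm_pow_four_le_mul_exp`)
bounds `sup_t ‖u(t)‖_{L⁴}`; "regularity follows" = Serrin with the constant majorant (tree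
`Torus.classicalNS_continuation_of_Ls_rpow_integral_le`, `s = 4 > 3`).
[cite: TranYu2015, Thm 2 (19)–(20)] -/
theorem Torus.classicalNS_continuation_of_L6_L4_ratio_integral_le (hd : Fintype.card d = 3)
    (hν : 0 < ν) (hT : 0 < T) (h : Torus.IsClassicalNSSolutionOn (Ico 0 T) ν 0 u p)
    (hmean : ∀ t ∈ Ico 0 T, Torus.HasZeroMean (u t)) {M : ℝ → ℝ}
    (hMc : ContinuousOn M (Ico 0 T))
    (hM : ∀ t ∈ Ico 0 T, ∫ x, ‖u t x‖ ^ 6 ≤ M t * ∫ x, ‖u t x‖ ^ 4)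
    {I : ℝ} (hI : ∀ t ∈ Ico 0 T, ∫ τ in (0 : ℝ)..t, M τ ≤ I) :
    ∃ T' : ℝ, T < T' ∧ ∃ (u' : ℝ → UnitAddTorus d → EuclideanSpace ℝ d)
      (p' : ℝ → UnitAddTorus d → ℝ), Torus.IsClassicalNSSolutionOn (Icc 0 T') ν 0 u' p' ∧
        (∀ t ∈ Icc 0 T', Torus.HasZeroMean (u' t)) ∧ ∀ t ∈ Ico 0 T, u' t = u t := by
  haveI : Nonempty d := by rw [← Fintype.card_pos_iff, hd]; norm_num
  obtain ⟨K, hK0, hK⟩ := Torus.exists_classicalNS_integral_norm_pow_four_le_mul_exp (d := d)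
  have hKν : 0 ≤ K / ν := div_nonneg hK0 hν.le
  set B : ℝ := (∫ x, ‖u 0 x‖ ^ 4) * Real.exp (K / ν * I) with hB
  have hU00 : 0 ≤ ∫ x, ‖u 0 x‖ ^ 4 := integral_nonneg fun x => pow_nonneg (norm_nonneg _) _
  have hB0 : 0 ≤ B := mul_nonneg hU00 (Real.exp_pos _).le
  have hbound : ∀ t ∈ Ico 0 T, ∫ x, ‖u t x‖ ^ 4 ≤ B := by
    intro t ht
    have h1 := hK hν h hMc hM t ht
    refine h1.trans (mul_le_mul_of_nonneg_left ?_ hU00)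
    exact Real.exp_le_exp.2 (mul_le_mul_of_nonneg_left (hI t ht) hKν)
  have e4 : ∀ t, ∫ x, ‖u t x‖ ^ (4 : ℝ) = ∫ x, ‖u t x‖ ^ 4 := fun t =>
    integral_congr_ae (ae_of_all _ fun x => by
      show ‖u t x‖ ^ (4 : ℝ) = ‖u t x‖ ^ 4
      exact_mod_cast Real.rpow_natCast ‖u t x‖ 4)
  refine Torus.classicalNS_continuation_of_Ls_rpow_integral_le hd hν hT (s := 4) (by norm_num) h
    hmean (N := fun _ => B ^ (1 / 4 : ℝ)) continuousOn_const (fun _ _ => Real.rpow_nonneg hB0 _)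
    (fun t ht => ?_) (I := T * (B ^ (1 / 4 : ℝ)) ^ (2 * 4 / (4 - 3) : ℝ)) fun t ht => ?_
  · rw [e4 t]
    exact Real.rpow_le_rpow (integral_nonneg fun x => pow_nonneg (norm_nonneg _) _)
      (hbound t ht) (by norm_num)
  · rw [intervalIntegral.integral_const, smul_eq_mul, sub_zero]
    exact mul_le_mul_of_nonneg_right ht.2.le (Real.rpow_nonneg (Real.rpow_nonneg hB0 _) _)

/-- **Tran–Yu's Corollary 3 on `T³`: `∫₀ᵀ ‖ω‖⁶_{L²}/‖u‖⁴_{L⁴} < ∞` prevents blow-up.** Printed: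
"If `∫₀ᵗ ‖ω‖⁶_{L²}/‖u‖⁴_{L⁴} dτ < ∞` (21), then
`‖u‖_{L⁴} ≤ ‖u₀‖_{L⁴} exp{c∫₀ᵗ ‖ω‖⁶_{L²}/‖u‖⁴_{L⁴} dτ}` (22) and regularity follows" (from Thm 2
"by invoking the Sobolev inequality" `‖u‖_{L⁶} ≤ c‖ω‖_{L²}`). Here, with the tree's periodic
Sobolev bound `∫|u|⁶ ≤ C_S (∫|∇u|²)³` for mean-zero fields
(`Torus.exists_integral_norm_pow_six_le_gradNormSq_cube`) and `∫|∇u|² = ∫|ω|²` for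
divergence-free fields (`integral_torusVorticitySqAt_eq_two_mul_torusEnstrophy`;
`torusVorticitySqAt u x = |∇×u(x)|²` on `T³`): a classical mean-zero solution of the unforced
equations on `[0, T) × T^d`, `card d = 3`, a continuous `M` with
`(∫|ω(t)|²)³ ≤ M(t) ∫‖u(t)‖⁴` and `∫₀ᵗ M ≤ I` on `[0, T)` continues past `T`.
[cite: TranYu2015, Cor 3 (21)–(22)] -/
theorem Torus.classicalNS_continuation_of_enstrophy_L4_ratio_integral_le
    (hd : Fintype.card d = 3) (hν : 0 < ν) (hT : 0 < T)
    (h : Torus.IsClassicalNSSolutionOn (Ico 0 T) ν 0 u p)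
    (hmean : ∀ t ∈ Ico 0 T, Torus.HasZeroMean (u t)) {M : ℝ → ℝ}
    (hMc : ContinuousOn M (Ico 0 T))
    (hM : ∀ t ∈ Ico 0 T,
      (∫ x, torusVorticitySqAt (u t) x) ^ 3 ≤ M t * ∫ x, ‖u t x‖ ^ 4)
    {I : ℝ} (hI : ∀ t ∈ Ico 0 T, ∫ τ in (0 : ℝ)..t, M τ ≤ I) :
    ∃ T' : ℝ, T < T' ∧ ∃ (u' : ℝ → UnitAddTorus d → EuclideanSpace ℝ d)
      (p' : ℝ → UnitAddTorus d → ℝ), Torus.IsClassicalNSSolutionOn (Icc 0 T') ν 0 u' p' ∧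
        (∀ t ∈ Icc 0 T', Torus.HasZeroMean (u' t)) ∧ ∀ t ∈ Ico 0 T, u' t = u t := by
  obtain ⟨CS, hCS0, hCS⟩ := Torus.exists_integral_norm_pow_six_le_gradNormSq_cube (d := d) hd
  -- the `L⁶/L⁴` majorant `C_S · M`
  refine Torus.classicalNS_continuation_of_L6_L4_ratio_integral_le hd hν hT h hmean
    (M := fun t => CS * M t) (continuousOn_const.mul hMc) (fun t ht => ?_) (I := CS * I)
    (fun t ht => ?_)
  · have hut : Torus.IsSmooth (u t) := h.smooth_velocity.isSmooth_slice ht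
    have hdivt : Torus.IsDivFree (u t) := h.divFree t ht
    have hω : ∫ x, torusVorticitySqAt (u t) x = Torus.gradNormSq (u t) := by
      rw [integral_torusVorticitySqAt_eq_two_mul_torusEnstrophy hut hdivt, torusEnstrophy]
      ring
    calc ∫ x, ‖u t x‖ ^ 6 ≤ CS * Torus.gradNormSq (u t) ^ 3 := hCS (u t) hut (hmean t ht)
      _ = CS * (∫ x, torusVorticitySqAt (u t) x) ^ 3 := by rw [hω]
      _ ≤ CS * (M t * ∫ x, ‖u t x‖ ^ 4) := mul_le_mul_of_nonneg_left (hM t ht) hCS0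
      _ = CS * M t * ∫ x, ‖u t x‖ ^ 4 := by ring
  · rw [intervalIntegral.integral_const_mul]
    exact mul_le_mul_of_nonneg_left (hI t ht) hCS0

end Criterion

end Literature.Analysis.FluidPDE

end
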